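import Summits.Ventures.HodgeRepro.TwoPrimePairing
import Summits.Ventures.HodgeRepro.TwoPowerTimesTwoNoSingleClass

/-!
# `C₂ × C_{2p}` (`p` an odd prime) carries no single-class `SumTwo` quadruple without a conjugate pair

Blind re-derivation cell `pub-hodge-repro`, seat `p1` (gen 11).  The family (iii) of P1.md §16g's «Consequence»:
`C₂ × C_{2p}` has `2`-rank `2` and the odd prime `p`, but `|G| = 4p < 8p`, so the involution rectangle (D) is out of
reach; the census found it EMPTY for `p = 3, 5, 7, 11, 13` and the paper argument was only local.  This file proves
the emptiness for EVERY odd prime `p` and every involution `c`, by the Klein-pair argument of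
`TwoPowerTimesTwoNoSingleClass.lean` transported from `ℤ/2^(a+1)` to `ℤ/2p`:

**Theorem** (`exists_conj_of_sumTwo_kleinPair_twoPrime`, abstract form).  `(G, c)` with two surjections
`φ₀, φ₁ : G →* ℤ/2p` sending `c` to `p`, kernels `{1, κ₀}`, `{1, κ₁}`, `κ₁ = κ₀ c`: every `SumTwo` quadruple of
Galois twists of a CM type has two complex-conjugate corners.

Proof.  The push-forward profiles `Pᵢ` are `{0,1,2}`-valued CM profiles on `ℤ/2p` with `∑ⱼ Pᵢ(x − φᵢ(gⱼ)) = 4`;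
`pairing_or_const_twoPrime` leaves three cases for each: `Pᵢ ≡ 1` (then `Φ` is `κ_{1−i}`-periodic and the quadruple
DESCENDS along `φ_{1−i}`), `Pᵢ` `{0,2}`-valued (then `1_Φ(z) = 1_Φ(κᵢ z)`: `Φ` is `κᵢ`-periodic and descends along
`φᵢ`), or a pairing with differences `p`.  A descended quadruple lives on `(ℤ/2p, p)`, where gen 8's cyclic theorem
(`N = 2 · 2⁰ · p¹`) supplies the conjugate pair, which pulls back (`exists_conj_of_periodic_cyclic`).  Two pairings
give the Klein contradiction exactly as before.  The concrete family `Multiplicative (ZMod 2 × ZMod (2p))` with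
its three involutions is in `TwoPrimeInstances.lean`.
-/

set_option autoImplicit false

open Finset AddChar ZMod Function
open scoped Pointwise

namespace HodgeRepro.TwoPowerTimesTwo

open HodgeRepro.CyclicQuad

variable {G : Type*} [Group G] [DecidableEq G] {N : ℕ} [NeZero N]

omit [NeZero N] in
/-- The push-forward profile takes the values `0, 1, 2`. -/
theorem push_values (φ : G →* Multiplicative (ZMod N)) (hφ : Surjective φ) {κ : G}
    (hker : ∀ z, φ z = 1 ↔ z = 1 ∨ z = κ) (hκ : κ ≠ 1) (Φ : Finset G) (x : ZMod N) :
    push φ Φ x = 0 ∨ push φ Φ x = 1 ∨ push φ Φ x = 2 := by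
  obtain ⟨w, hw⟩ := hφ (Multiplicative.ofAdd x)
  have e1 : x = Multiplicative.toAdd (φ w) := by rw [hw, toAdd_ofAdd]
  subst e1
  rw [push_apply φ hker hκ]
  by_cases h1 : w ∈ Φ <;> by_cases h2 : κ * w ∈ Φ <;> norm_num [h1, h2]

omit [NeZero N] in
/-- A `{0, 2}`-valued profile makes the type `κ`-periodic: `z ∈ Φ ↔ κ z ∈ Φ`. -/
theorem periodic_of_push_two (φ : G →* Multiplicative (ZMod N)) {κ : G}
    (hker : ∀ z, φ z = 1 ↔ z = 1 ∨ z = κ) (hκ : κ ≠ 1) (Φ : Finset G)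
    (h : ∀ x, push φ Φ x = 0 ∨ push φ Φ x = 2) (z : G) : z ∈ Φ ↔ κ * z ∈ Φ := by
  have hz := h (Multiplicative.toAdd (φ z))
  rw [push_apply φ hker hκ] at hz
  by_cases h1 : z ∈ Φ <;> by_cases h2 : κ * z ∈ Φ <;> simp [h1, h2] at hz ⊢

/-- **Descent, general cyclic target.**  A `κ`-periodic CM type with a `SumTwo` quadruple of twists on `(G, c)`,
`ker φ = {1, κ}`, `φ c = N/2`, `N = 2 · 2^a q^b` (`q` an odd prime), has a conjugate pair: the quadruple descends to
`(ℤ/N, N/2)`, gen 8's cyclic theorem applies, and the pair pulls back. -/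
theorem exists_conj_of_periodic_cyclic {a b q : ℕ} (hq : q.Prime) (hq2 : q ≠ 2)
    (hN : N = 2 * (2 ^ a * q ^ b)) (φ : G →* Multiplicative (ZMod N)) (hφ : Surjective φ) {c : G}
    (hc : IsComplexConj c) (hcm : φ c = Multiplicative.ofAdd ((2 ^ a * q ^ b : ℕ) : ZMod N)) {κ : G}
    (hker : ∀ z, φ z = 1 ↔ z = 1 ∨ z = κ) (Φ : Finset G) (hΦ : IsCMType c Φ)
    (hper : ∀ z, z ∈ Φ ↔ κ * z ∈ Φ) (g : Fin 4 → G) (hs : SumTwo (fun i => rmul Φ (g i))) :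
    ∃ i j : Fin 4, rmul Φ (g j) = c • rmul Φ (g i) := by
  have hmem : ∀ z, φ z ∈ Φ.image φ ↔ z ∈ Φ := mem_image_iff_of_periodic φ hker Φ hper
  have hΦ' : IsCMType (Multiplicative.ofAdd ((2 ^ a * q ^ b : ℕ) : ZMod N)) (Φ.image φ) := by
    intro x
    obtain ⟨w, rfl⟩ := hφ x
    rw [hmem, ← hcm, ← map_mul, hmem]
    exact hΦ w
  have htw : ∀ (i : Fin 4) (z : G), φ z ∈ rmul (Φ.image φ) (φ (g i)) ↔ z ∈ rmul Φ (g i) := by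
    intro i z
    rw [mem_rmul, mem_rmul, ← map_inv, ← map_mul, hmem]
  have hs' : SumTwo (fun i => rmul (Φ.image φ) (φ (g i))) := by
    intro x
    obtain ⟨w, rfl⟩ := hφ x
    rw [← hs w]
    congr 1
    ext i
    simp only [mem_filter, mem_univ, true_and]
    exact htw i w
  obtain ⟨i, j, hij⟩ := exists_conj_of_sumTwo_cyclic hq hq2 hN (Φ.image φ) hΦ' (fun i => φ (g i)) hs'
  refine ⟨i, j, ?_⟩
  ext z
  rw [← htw j z, hij, (isComplexConj_ofAdd_half hN).mem_smul_iff, ← hcm, ← map_mul, htw i (c * z),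
    hc.mem_smul_iff]

/-- **Main theorem (abstract form, `ℤ/2p`).**  `(G, c)` with two surjections `φ₀, φ₁ : G →* ℤ/2p` (`p` an odd
prime) sending `c` to `p`, kernels `{1, κ₀}`, `{1, κ₁}`, `κ₁ = κ₀ c`: every `SumTwo` quadruple of Galois twists of a
CM type has two complex-conjugate corners. -/
theorem exists_conj_of_sumTwo_kleinPair_twoPrime {p : ℕ} (hp : p.Prime) (hp2 : p ≠ 2) (hN : N = 2 * p)
    {c : G} (hc : IsComplexConj c) (φ₀ φ₁ : G →* Multiplicative (ZMod N)) (hφ₀ : Surjective φ₀)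
    (hφ₁ : Surjective φ₁) (hc₀ : φ₀ c = Multiplicative.ofAdd (p : ZMod N))
    (hc₁ : φ₁ c = Multiplicative.ofAdd (p : ZMod N))
    {κ₀ κ₁ : G} (hk₀ : ∀ z, φ₀ z = 1 ↔ z = 1 ∨ z = κ₀) (hk₁ : ∀ z, φ₁ z = 1 ↔ z = 1 ∨ z = κ₁)
    (hκ₀ : κ₀ ≠ 1) (hκ₁ : κ₁ ≠ 1) (hκ : κ₁ = κ₀ * c)
    (Φ : Finset G) (hΦ : IsCMType c Φ) (g : Fin 4 → G) (hs : SumTwo (fun i => rmul Φ (g i))) :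
    ∃ i j : Fin 4, rmul Φ (g j) = c • rmul Φ (g i) := by
  by_contra hnc'
  have hnc : ∀ i j : Fin 4, rmul Φ (g j) ≠ c • rmul Φ (g i) := fun i j h => hnc' ⟨i, j, h⟩
  have hN' : N = 2 * (2 ^ 0 * p ^ 1) := by rw [hN]; ring
  have hcm' : ((2 ^ 0 * p ^ 1 : ℕ) : ZMod N) = (p : ZMod N) := by push_cast; ring
  have hc₀' : φ₀ c = Multiplicative.ofAdd ((2 ^ 0 * p ^ 1 : ℕ) : ZMod N) := by rw [hc₀, hcm']
  have hc₁' : φ₁ c = Multiplicative.ofAdd ((2 ^ 0 * p ^ 1 : ℕ) : ZMod N) := by rw [hc₁, hcm']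
  -- the two descents
  have desc₀ : (∀ z, z ∈ Φ ↔ κ₀ * z ∈ Φ) → False := fun hper =>
    hnc' (exists_conj_of_periodic_cyclic hp hp2 hN' φ₀ hφ₀ hc hc₀' hk₀ Φ hΦ hper g hs)
  have desc₁ : (∀ z, z ∈ Φ ↔ κ₁ * z ∈ Φ) → False := fun hper =>
    hnc' (exists_conj_of_periodic_cyclic hp hp2 hN' φ₁ hφ₁ hc hc₁' hk₁ Φ hΦ hper g hs)
  have hP₀ := pairing_or_const_twoPrime hp hp2 hN (push φ₀ Φ) (push_add_half φ₀ hφ₀ hk₀ hκ₀ hc hc₀ Φ hΦ)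
    (push_values φ₀ hφ₀ hk₀ hκ₀ Φ) (fun i => Multiplicative.toAdd (φ₀ (g i)))
    (sum_push_twists φ₀ hφ₀ hk₀ hκ₀ Φ g hs)
  have hP₁ := pairing_or_const_twoPrime hp hp2 hN (push φ₁ Φ) (push_add_half φ₁ hφ₁ hk₁ hκ₁ hc hc₁ Φ hΦ)
    (push_values φ₁ hφ₁ hk₁ hκ₁ Φ) (fun i => Multiplicative.toAdd (φ₁ (g i)))
    (sum_push_twists φ₁ hφ₁ hk₁ hκ₁ Φ g hs)
  rcases hP₀ with h₀ | h₀ | h₀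
  · -- `P₀ ≡ 1`: `Φ` is `κ₀ c = κ₁`-periodic
    exact desc₁ (fun z => by rw [hκ]; exact periodic_of_push_eq_one φ₀ hk₀ hκ₀ Φ hΦ h₀ z)
  · -- `P₀` two-valued: `Φ` is `κ₀`-periodic
    exact desc₀ (periodic_of_push_two φ₀ hk₀ hκ₀ Φ h₀)
  rcases hP₁ with h₁ | h₁ | h₁
  · -- `P₁ ≡ 1`: `Φ` is `κ₁ c = κ₀`-periodic
    refine desc₀ (fun z => ?_)
    have h := periodic_of_push_eq_one φ₁ hk₁ hκ₁ Φ hΦ h₁ z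
    rwa [hκ, mul_assoc κ₀ c c, hc.mul_self, mul_one] at h
  · exact desc₁ (periodic_of_push_two φ₁ hk₁ hκ₁ Φ h₁)
  -- both pairings: the Klein step
  have K₀ : ∀ i j : Fin 4, Multiplicative.toAdd (φ₀ (g i)) - Multiplicative.toAdd (φ₀ (g j)) =
      (p : ZMod N) → g i * (g j)⁻¹ = κ₁ := fun i j h => by
    rw [hκ]; exact mul_inv_eq_kappa φ₀ hc hc₀ hk₀ Φ g hnc i j h
  have K₁ : ∀ i j : Fin 4, Multiplicative.toAdd (φ₁ (g i)) - Multiplicative.toAdd (φ₁ (g j)) =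
      (p : ZMod N) → g i * (g j)⁻¹ = κ₀ := fun i j h => by
    have h' := mul_inv_eq_kappa φ₁ hc hc₁ hk₁ Φ g hnc i j h
    rwa [hκ, mul_assoc κ₀ c c, hc.mul_self, mul_one] at h'
  have hκ₀sq : κ₀ * κ₀ = 1 := by
    have h1 : φ₀ (κ₀ * κ₀) = 1 := by rw [map_mul, (hk₀ κ₀).mpr (Or.inr rfl), one_mul]
    rcases (hk₀ _).mp h1 with h2 | h2
    · exact h2
    · exact absurd (mul_eq_left.mp h2) hκ₀
  have hκ₀inv : κ₀⁻¹ = κ₀ := inv_eq_of_mul_eq_one_right hκ₀sq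
  have hκκ : κ₁ * κ₀ = c := by rw [hκ, mul_assoc, hc.comm κ₀, ← mul_assoc, hκ₀sq, one_mul]
  have hne : κ₁ ≠ κ₀ := by
    intro h
    apply hc.ne_one
    have h' : κ₀ * c = κ₀ * 1 := by rw [mul_one, ← hκ, h]
    exact mul_left_cancel h'
  have chain : ∀ i j k : Fin 4, g i * (g j)⁻¹ = κ₁ → g j * (g k)⁻¹ = κ₀ → False := by
    intro i j k h1 h2
    apply hnc k i
    have h3 : g i = c * g k := by
      rw [← hκκ, ← h1, ← h2]; group
    rw [h3, rmul_mul_conj hc]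
  have flip : ∀ j k : Fin 4, g k * (g j)⁻¹ = κ₀ → g j * (g k)⁻¹ = κ₀ := by
    intro j k h
    rw [← hκ₀inv, ← h, mul_inv_rev, inv_inv]
  rcases h₀ with ⟨h01, h23⟩ | ⟨h02, h13⟩ | ⟨h03, h12⟩ <;>
    rcases h₁ with ⟨h01', h23'⟩ | ⟨h02', h13'⟩ | ⟨h03', h12'⟩
  · exact hne ((K₀ 0 1 h01).symm.trans (K₁ 0 1 h01'))
  · exact chain 0 1 3 (K₀ 0 1 h01) (K₁ 1 3 h13')
  · exact chain 0 1 2 (K₀ 0 1 h01) (K₁ 1 2 h12')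
  · exact chain 0 2 3 (K₀ 0 2 h02) (K₁ 2 3 h23')
  · exact hne ((K₀ 0 2 h02).symm.trans (K₁ 0 2 h02'))
  · exact chain 0 2 1 (K₀ 0 2 h02) (flip 2 1 (K₁ 1 2 h12'))
  · exact chain 0 3 2 (K₀ 0 3 h03) (flip 3 2 (K₁ 2 3 h23'))
  · exact chain 0 3 1 (K₀ 0 3 h03) (flip 3 1 (K₁ 1 3 h13'))
  · exact hne ((K₀ 0 3 h03).symm.trans (K₁ 0 3 h03'))

end HodgeRepro.TwoPowerTimesTwo
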